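import Mathlib.RingTheory.MvPolynomial.EulerIdentity
import Summits.MatrixMultiplication.MatrixMultiplication.Theorems.ObstructionDescentCoordinateDegree

set_option linter.dupNamespace false

/-!
# Obstruction descent — the `sl₂` LADDER for the polarisation operators (def-free operator calculus)

`route-MatrixMultiplication-ObstructionDescent`, crux `NoOccurrenceObstruction` (stmt 29040); decomp-mm lens-3, NODE-g27 §4.
Part 1 of the DOMINANCE kernel (`ObstructionDescentDominance`: live types `Λ` of `hwvSpace Λ d ≠ ⊥` are monotone).

The polarisation operators of slot `0`, `D_{i→j} = Σ_q x_{(j,q)} ∂/∂x_{(i,q)}`, are passed as a PARAMETER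
`P : Fin m → Fin m → (ℂ[x] → ℂ[x])` together with their defining formula `hP` (the kernel declares no definitions);
`P i i = N_i` is the slice Euler operator.  Slice weights are the weights `𝟙[p₀ = a]` on variables, handled through
Mathlib's `IsWeightedHomogeneous`.  Proved here:
* §1 `[D_{i→j}, D_{j→i}] = N_j - N_i` (`polar_comm_rel`), from `∂_p D_{i→j} = 𝟙[p₀=j] ∂_{(i,p')} + D_{i→j} ∂_p`;
* §2 the slice Euler identity `N_a f = λ_a·f` (`polar_self`, from Mathlib's weighted Euler identity) and the weight shifts
  `e + 𝟙[i=a] = n + 𝟙[j=a]` of `D_{i→j}` (`polar_isWeightedHomogeneous`);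
* §3 the LADDER: if `D_{i→j} f = 0` for `f ≠ 0` of slice weights `(λ_i, λ_j)` then, with `Δ = D_{j→i}`,
  `D Δ^{k+1} f = (k+1)(λ_j - λ_i - k)·Δ^k f` (`ladder`), `Δ^{λ_j+1} f = 0` (`iterate_polar_eq_zero`), and therefore
  `λ_i ≤ λ_j` (`le_of_polar_eq_zero`) — the highest weight of a finite `sl₂`-string is non-negative.

[folklore: `sl₂` representation theory; Euler's identity] [cite: LandsbergGCT2017, §7.1]
-/

noncomputable section

open scoped BigOperators

namespace Summit.MatrixMultiplication.MatrixMultiplication.Theorems.ObstructionDescentPolarLadder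

open Summit.MatrixMultiplication.MatrixMultiplication.Theorems.ObstructionCalculus
open MvPolynomial (pderiv X)

variable {m : ℕ}

/-! ### §1 Polarisation operators and the `sl₂` commutation relation -/

section Polar

variable {P : Fin m → Fin m → MvPolynomial (Idx m) ℂ → MvPolynomial (Idx m) ℂ}

/-- `D_{i→j}` is additive. [bookkeeping] -/
theorem polar_add (hP : ∀ i j f, P i j f = ∑ q : Fin m × Fin m, X ((j, q) : Idx m) * pderiv ((i, q) : Idx m) f)
    (i j : Fin m) (f g : MvPolynomial (Idx m) ℂ) : P i j (f + g) = P i j f + P i j g := by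
  simp only [hP, map_add, mul_add, Finset.sum_add_distrib]

/-- `D_{i→j}` commutes with scalars. [bookkeeping] -/
theorem polar_smul (hP : ∀ i j f, P i j f = ∑ q : Fin m × Fin m, X ((j, q) : Idx m) * pderiv ((i, q) : Idx m) f)
    (i j : Fin m) (c : ℂ) (f : MvPolynomial (Idx m) ℂ) : P i j (c • f) = c • P i j f := by
  simp only [hP, Derivation.map_smul, mul_smul_comm, Finset.smul_sum]

/-- `D_{i→j} 0 = 0`. [bookkeeping] -/
theorem polar_zero (hP : ∀ i j f, P i j f = ∑ q : Fin m × Fin m, X ((j, q) : Idx m) * pderiv ((i, q) : Idx m) f)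
    (i j : Fin m) : P i j 0 = 0 := by
  simp only [hP, map_zero, mul_zero, Finset.sum_const_zero]

/-- Mixed partial derivatives commute. [bookkeeping] -/
theorem pderiv_comm (p p' : Idx m) (f : MvPolynomial (Idx m) ℂ) :
    pderiv p (pderiv p' f) = pderiv p' (pderiv p f) := by
  classical
  rcases eq_or_ne p p' with rfl | h
  · rfl
  ext μ
  simp only [MvPolynomial.coeff_pderiv]
  rw [add_right_comm μ (Finsupp.single p 1) (Finsupp.single p' 1)]
  simp only [Finsupp.coe_add, Pi.add_apply, Finsupp.single_apply, if_neg h, if_neg h.symm, add_zero]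
  ring

/-- Derivative of a polarisation: `∂_p D_{i→j} f = 𝟙[p₀ = j]·∂_{(i,p')} f + D_{i→j} ∂_p f`. [bookkeeping] -/
theorem pderiv_polar (hP : ∀ i j f, P i j f = ∑ q : Fin m × Fin m, X ((j, q) : Idx m) * pderiv ((i, q) : Idx m) f)
    (i j : Fin m) (p : Idx m) (f : MvPolynomial (Idx m) ℂ) :
    pderiv p (P i j f) = (if p.1 = j then pderiv ((i, p.2) : Idx m) f else 0) + P i j (pderiv p f) := by
  classical
  obtain ⟨a, q₀⟩ := p
  dsimp only
  have hsplit : ∀ q : Fin m × Fin m,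
      pderiv ((a, q₀) : Idx m) (X ((j, q) : Idx m) * pderiv ((i, q) : Idx m) f) =
        pderiv ((a, q₀) : Idx m) (X ((j, q) : Idx m)) * pderiv ((i, q) : Idx m) f +
          X ((j, q) : Idx m) * pderiv ((i, q) : Idx m) (pderiv ((a, q₀) : Idx m) f) := by
    intro q
    rw [MvPolynomial.pderiv_mul, pderiv_comm]
  rw [hP, map_sum, Finset.sum_congr rfl (fun q _ => hsplit q), Finset.sum_add_distrib, ← hP]
  congr 1
  by_cases ha : a = j
  · rw [if_pos ha, Finset.sum_eq_single q₀]
    · rw [ha, MvPolynomial.pderiv_X_self, one_mul]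
    · intro q _ hq
      rw [MvPolynomial.pderiv_X_of_ne, zero_mul]
      exact fun h => hq (Prod.ext_iff.mp h).2
    · exact fun h => absurd (Finset.mem_univ _) h
  · rw [if_neg ha]
    refine Finset.sum_eq_zero fun q _ => ?_
    rw [MvPolynomial.pderiv_X_of_ne, zero_mul]
    exact fun h => ha ((Prod.ext_iff.mp h).1).symm

/-- **The `sl₂` commutation relation** `[D_{i→j}, D_{j→i}] = N_j - N_i`. [folklore] -/
theorem polar_comm_rel (hP : ∀ i j f, P i j f = ∑ q : Fin m × Fin m, X ((j, q) : Idx m) * pderiv ((i, q) : Idx m) f)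
    (i j : Fin m) (f : MvPolynomial (Idx m) ℂ) :
    P i j (P j i f) - P j i (P i j f) = P j j f - P i i f := by
  classical
  have expand : ∀ a b : Fin m, P a b (P b a f) = P b b f +
      ∑ q' : Fin m × Fin m, X ((b, q') : Idx m) * P b a (pderiv ((a, q') : Idx m) f) := by
    intro a b
    calc P a b (P b a f)
        = ∑ q' : Fin m × Fin m, X ((b, q') : Idx m) * pderiv ((a, q') : Idx m) (P b a f) := hP _ _ _
      _ = ∑ q' : Fin m × Fin m, X ((b, q') : Idx m) *
            (pderiv ((b, q') : Idx m) f + P b a (pderiv ((a, q') : Idx m) f)) := by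
          refine Finset.sum_congr rfl fun q' _ => ?_
          rw [pderiv_polar hP, if_pos rfl]
      _ = _ := by
          rw [hP b b f, ← Finset.sum_add_distrib]
          exact Finset.sum_congr rfl fun q' _ => mul_add _ _ _
  have hT : (∑ q' : Fin m × Fin m, X ((j, q') : Idx m) * P j i (pderiv ((i, q') : Idx m) f)) =
      ∑ q' : Fin m × Fin m, X ((i, q') : Idx m) * P i j (pderiv ((j, q') : Idx m) f) := by
    simp only [hP, Finset.mul_sum]
    rw [Finset.sum_comm]
    refine Finset.sum_congr rfl fun u _ => Finset.sum_congr rfl fun v _ => ?_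
    rw [pderiv_comm]
    ring
  rw [expand i j, expand j i, hT]
  ring

/-! ### §2 The slice Euler identity and the weight shifts of polarisation -/

/-- The slice-weighted Euler sum collapses to the slice. [bookkeeping] -/
theorem sum_sliceWt_smul (a : Fin m) (g : Idx m → MvPolynomial (Idx m) ℂ) :
    (∑ p : Idx m, (fun p : Idx m => if p.1 = a then (1 : ℕ) else 0) p • g p) = ∑ q : Fin m × Fin m, g (a, q) := by
  rw [Fintype.sum_prod_type]
  simp only [ite_smul, one_smul, zero_smul]
  rw [Finset.sum_eq_single a (fun a' _ ha' => by simp [ha']) (fun h => absurd (Finset.mem_univ a) h)]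
  simp

/-- **Slice Euler identity:** `N_a f = λ_a · f` for `f` slice-`a`-homogeneous of slice weight `λ_a`.
[folklore: Euler's identity, weighted form (Mathlib `IsWeightedHomogeneous.sum_weight_X_mul_pderiv`)] -/
theorem polar_self (hP : ∀ i j f, P i j f = ∑ q : Fin m × Fin m, X ((j, q) : Idx m) * pderiv ((i, q) : Idx m) f)
    (a : Fin m) {f : MvPolynomial (Idx m) ℂ} {n : ℕ}
    (hf : f.IsWeightedHomogeneous (fun p : Idx m => if p.1 = a then (1 : ℕ) else 0) n) : P a a f = (n : ℂ) • f := by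
  have h := hf.sum_weight_X_mul_pderiv
  rw [sum_sliceWt_smul] at h
  rw [hP, h, Nat.cast_smul_eq_nsmul]

/-- **Weight shift:** for `i ≠ j`, `D_{i→j}` maps slice-`a` weight `n` to slice-`a` weight `e`, where
`e + 𝟙[i=a] = n + 𝟙[j=a]` (lowers slice `i`, raises slice `j`, preserves the others). [folklore] -/
theorem polar_isWeightedHomogeneous
    (hP : ∀ i j f, P i j f = ∑ q : Fin m × Fin m, X ((j, q) : Idx m) * pderiv ((i, q) : Idx m) f)
    {a i j : Fin m} (hij : i ≠ j) {f : MvPolynomial (Idx m) ℂ} {n e : ℕ}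
    (hf : f.IsWeightedHomogeneous (fun p : Idx m => if p.1 = a then (1 : ℕ) else 0) n)
    (he : e + (if i = a then 1 else 0) = n + (if j = a then 1 else 0)) :
    (P i j f).IsWeightedHomogeneous (fun p : Idx m => if p.1 = a then (1 : ℕ) else 0) e := by
  classical
  rw [hP]
  refine MvPolynomial.IsWeightedHomogeneous.sum _ _ _ fun q _ => ?_
  have hX := MvPolynomial.isWeightedHomogeneous_X (R := ℂ) (fun p : Idx m => if p.1 = a then (1 : ℕ) else 0)
    ((j, q) : Idx m)
  rcases eq_or_ne i a with hia | hia <;> rcases eq_or_ne j a with hja | hja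
  · exact absurd (hia.trans hja.symm) hij
  all_goals
    simp only [hia, hja, if_true, if_false] at he
    have hn : (e - (if j = a then 1 else 0)) + (fun p : Idx m => if p.1 = a then (1 : ℕ) else 0) ((i, q) : Idx m)
        = n := by
      simp only [hia, hja, if_true, if_false]; omega
    have h := hX.mul (hf.pderiv hn)
    convert h using 1
    simp only [hja, if_true, if_false]; omega

/-- A slice-`a`-homogeneous polynomial of slice weight `0` contains no variable of slice `a`. [bookkeeping] -/
theorem pderiv_eq_zero_of_weight_zero {a : Fin m} {f : MvPolynomial (Idx m) ℂ}
    (hf : f.IsWeightedHomogeneous (fun p : Idx m => if p.1 = a then (1 : ℕ) else 0) 0) (q : Fin m × Fin m) :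
    pderiv ((a, q) : Idx m) f = 0 := by
  classical
  ext μ
  rw [MvPolynomial.coeff_pderiv, MvPolynomial.coeff_zero, hf.coeff_eq_zero, zero_mul]
  rw [map_add, Finsupp.weight_single]
  simp

/-- Hence `D_{a→j} f = 0` when the slice-`a` weight of `f` is `0`. [bookkeeping] -/
theorem polar_eq_zero_of_weight_zero
    (hP : ∀ i j f, P i j f = ∑ q : Fin m × Fin m, X ((j, q) : Idx m) * pderiv ((i, q) : Idx m) f)
    {a j : Fin m} {f : MvPolynomial (Idx m) ℂ}
    (hf : f.IsWeightedHomogeneous (fun p : Idx m => if p.1 = a then (1 : ℕ) else 0) 0) : P a j f = 0 := by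
  simp [hP, pderiv_eq_zero_of_weight_zero hf]

end Polar

/-! ### §3 The `sl₂` ladder: `D_{i→j} f = 0`, `f ≠ 0` force `λ_i ≤ λ_j` -/

section Ladder

variable {P : Fin m → Fin m → MvPolynomial (Idx m) ℂ → MvPolynomial (Idx m) ℂ}
  {i j : Fin m} {f : MvPolynomial (Idx m) ℂ} {li lj : ℕ}

/-- Slice weights along the ladder `Δ^k f`, `Δ = D_{j→i}`: `(λ_i + k, λ_j - k)` for `k ≤ λ_j`. [folklore] -/
theorem iterate_polar_isWeightedHomogeneous
    (hP : ∀ i j f, P i j f = ∑ q : Fin m × Fin m, X ((j, q) : Idx m) * pderiv ((i, q) : Idx m) f) (hij : i ≠ j)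
    (hi : f.IsWeightedHomogeneous (fun p : Idx m => if p.1 = i then (1 : ℕ) else 0) li)
    (hj : f.IsWeightedHomogeneous (fun p : Idx m => if p.1 = j then (1 : ℕ) else 0) lj) (k : ℕ) (hk : k ≤ lj) :
    ((P j i)^[k] f).IsWeightedHomogeneous (fun p : Idx m => if p.1 = i then (1 : ℕ) else 0) (li + k) ∧
      ((P j i)^[k] f).IsWeightedHomogeneous (fun p : Idx m => if p.1 = j then (1 : ℕ) else 0) (lj - k) := by
  induction k with
  | zero => simpa using And.intro hi hj
  | succ k ih =>
    obtain ⟨h1, h2⟩ := ih (Nat.le_of_succ_le hk)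
    rw [Function.iterate_succ_apply']
    refine ⟨polar_isWeightedHomogeneous hP hij.symm h1 ?_, polar_isWeightedHomogeneous hP hij.symm h2 ?_⟩
    · rw [if_neg hij.symm, if_pos rfl]; omega
    · rw [if_pos rfl, if_neg hij]; omega

/-- **Ladder identity:** `D_{i→j} Δ^{k+1} f = (k+1)(λ_j - λ_i - k)·Δ^k f` for `k ≤ λ_j`, when `D_{i→j} f = 0`.
[folklore: `sl₂` representation theory] -/
theorem ladder (hP : ∀ i j f, P i j f = ∑ q : Fin m × Fin m, X ((j, q) : Idx m) * pderiv ((i, q) : Idx m) f)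
    (hij : i ≠ j) (hi : f.IsWeightedHomogeneous (fun p : Idx m => if p.1 = i then (1 : ℕ) else 0) li)
    (hj : f.IsWeightedHomogeneous (fun p : Idx m => if p.1 = j then (1 : ℕ) else 0) lj) (hD : P i j f = 0)
    (k : ℕ) (hk : k ≤ lj) :
    P i j ((P j i)^[k + 1] f) = (((k : ℂ) + 1) * ((lj : ℂ) - li - k)) • (P j i)^[k] f := by
  induction k with
  | zero =>
    have hc := polar_comm_rel hP i j f
    rw [hD, polar_zero hP, sub_zero, polar_self hP j hj, polar_self hP i hi, ← sub_smul] at hc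
    simp only [Function.iterate_succ_apply', Function.iterate_zero_apply]
    rw [hc]
    congr 1; push_cast; ring
  | succ k ih =>
    have hk' : k ≤ lj := Nat.le_of_succ_le hk
    obtain ⟨h1, h2⟩ := iterate_polar_isWeightedHomogeneous hP hij hi hj (k + 1) hk
    have hc := polar_comm_rel hP i j ((P j i)^[k + 1] f)
    rw [ih hk', polar_smul hP, polar_self hP j h2, polar_self hP i h1, ← Function.iterate_succ_apply' (P j i) k,
      sub_eq_iff_eq_add, ← sub_smul, ← add_smul] at hc
    rw [Function.iterate_succ_apply' (P j i) (k + 1), hc]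
    congr 1; push_cast [Nat.cast_sub hk]; ring

/-- **Termination:** `Δ^{λ_j + 1} f = 0` — the slice-`j` weight is exhausted. [folklore] -/
theorem iterate_polar_eq_zero
    (hP : ∀ i j f, P i j f = ∑ q : Fin m × Fin m, X ((j, q) : Idx m) * pderiv ((i, q) : Idx m) f) (hij : i ≠ j)
    (hi : f.IsWeightedHomogeneous (fun p : Idx m => if p.1 = i then (1 : ℕ) else 0) li)
    (hj : f.IsWeightedHomogeneous (fun p : Idx m => if p.1 = j then (1 : ℕ) else 0) lj) :
    (P j i)^[lj + 1] f = 0 := by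
  rw [Function.iterate_succ_apply']
  exact polar_eq_zero_of_weight_zero hP
    (by simpa using (iterate_polar_isWeightedHomogeneous hP hij hi hj lj le_rfl).2)

/-- **The `sl₂` lemma:** a NON-ZERO polynomial of slice weights `(λ_i, λ_j)` killed by `D_{i→j}` has `λ_i ≤ λ_j`.
[folklore: the highest weight of a finite-dimensional `sl₂`-string is `≥ 0`] -/
theorem le_of_polar_eq_zero
    (hP : ∀ i j f, P i j f = ∑ q : Fin m × Fin m, X ((j, q) : Idx m) * pderiv ((i, q) : Idx m) f) (hij : i ≠ j)
    (hf0 : f ≠ 0) (hi : f.IsWeightedHomogeneous (fun p : Idx m => if p.1 = i then (1 : ℕ) else 0) li)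
    (hj : f.IsWeightedHomogeneous (fun p : Idx m => if p.1 = j then (1 : ℕ) else 0) lj) (hD : P i j f = 0) :
    li ≤ lj := by
  classical
  have hex : ∃ k, (P j i)^[k] f = 0 := ⟨lj + 1, iterate_polar_eq_zero hP hij hi hj⟩
  obtain ⟨K', hK'⟩ : ∃ K', Nat.find hex = K' + 1 :=
    Nat.exists_eq_succ_of_ne_zero fun h => hf0 (by simpa [h] using Nat.find_spec hex)
  have hKz : (P j i)^[K' + 1] f = 0 := hK' ▸ Nat.find_spec hex
  have hne : (P j i)^[K'] f ≠ 0 := Nat.find_min hex (by omega)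
  have hle : K' ≤ lj := by
    have := Nat.find_min' hex (iterate_polar_eq_zero hP hij hi hj); omega
  have hlad := ladder hP hij hi hj hD K' hle
  rw [hKz, polar_zero hP] at hlad
  have hc : ((K' : ℂ) + 1) * ((lj : ℂ) - li - K') = 0 := by
    rcases smul_eq_zero.mp hlad.symm with h | h
    · exact h
    · exact absurd h hne
  have h1 : (K' : ℂ) + 1 ≠ 0 := by exact_mod_cast Nat.succ_ne_zero K'
  have h2 : (lj : ℂ) - li - K' = 0 := (mul_eq_zero.mp hc).resolve_left h1
  have h3 : (lj : ℂ) = li + K' := by linear_combination h2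
  have h4 : lj = li + K' := by exact_mod_cast h3
  omega

end Ladder

end Summit.MatrixMultiplication.MatrixMultiplication.Theorems.ObstructionDescentPolarLadder
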